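import Summits.HodgeConjecture.HodgeConjecture.Theorems.Ring2HypothesesDescentMotivatedTranspose
import Summits.HodgeConjecture.HodgeConjecture.Theorems.Ring2HypothesesDescentMotivatedStarAdjoint
import Mathlib.LinearAlgebra.Trace
import HarnessLib

/-!
# Ring 2 hypotheses, descent face — THE LEFSCHETZ TRACE FORMULA FOR CORRESPONDENCE CLASSES on the real carriers, I:
# cross products act as rank-one operators, the graded trace `Σₐ (-1)ᵃ Tr([u]_* | Hᵃ(X(ℂ))) · 1 = p₁₊ p₂^* Δ^* u`,
# and the trace formula `Σₐ (-1)ᵃ Tr([w]_* ∘ [u]_* | Hᵃ) · 1 = p₁₊ p₂^* p₁₊ (u ∪ σ^* w)` on cross products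

research route conditional on HC_CM; not a corollary; Q11.4-sentence-2 already refuted in dim ≥ 3.
Cell `pub-hodge-ring2` (Hodge ladder STAGE 3), seat `ring2-b05` (binder row b05
`Ring2.Hypotheses.MotivatedImpliesAlgebraicAV`), gen 37. `HC_CM` (`Theses.RankFourFaces.CMAbelianHodge`) does
not occur in this file; nothing here proves a case of the Hodge conjecture; the row b05 stays OPEN.

André 1996 uses «la formule de trace» `⟨f ∪ ᵗg⟩ = Σᵢ (-1)ⁱ Tr_{Hⁱ}(f ∘ g)` (proof of Prop. 3.1, p. 20; Kleiman 1968,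
Prop. 1.3.6: «`⟨u · ᵗw⟩ = Σ (-1)ⁱ Tr(w ∘ u | Hⁱ(X))`») to show that nil ideals of motivated correspondences are
numerically trivial — the step of Prop. 3.1 / Prop. 3.3 («la `ℚ`-algèbre `C⁰_mot(X, X)` est semi-simple») that the
sequel `…MotivatedSemisimple` carries out. The tree had no trace formula on the real carriers
`complexBetti X a = Hᵃ(X(ℂ); ℂ)` with the orientation-family correspondence action
`corrAction μ hX hX rfl u = [u]_* = p₁₊(p₂^*(·) ∪ u) : Hᵃ → Hᵃ` (`u ∈ H²ⁿ((X ⊗ X)(ℂ))`, `n = dim X`). This file proves it,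
scalar-free: every scalar is displayed as a multiple of `1_X ∈ H⁰(X(ℂ); ℂ)` through the degree-`0` «fibre integral»
`p₁₊ p₂^* : H²ⁿ(X(ℂ)) → H⁰(X(ℂ))`.

* §1 `corrAction_cross_apply`, `corrAction_cross_eq_zero_of_ne`, `corrAction_cross_apply_self` — a cross product
  `x ⊠ y = p₁^* x ∪ p₂^* y` (`x ∈ Hⁱ`, `y ∈ Hʲ`, `i + j = 2n`) acts as ZERO on `Hᵃ` for `a ≠ i` and as the RANK-ONE
  operator `c ↦ (-1)ⁱ x ∪ p₁₊ p₂^*(c ∪ y)` on `Hⁱ` (projection formula, vanishing below the fibre dimension).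
* §2 `exists_fibreIntegral` — `p₁₊ p₂^* w = φ(w) · 1_X` for a linear functional `φ` on `H²ⁿ(X(ℂ))`.
* §3 **`gradedTrace_corrAction_smul_one`** — `(Σ_{a ≤ 2n} (-1)ᵃ Tr([u]_*|Hᵃ)) · 1_X = p₁₊ p₂^* Δ^* u` (Lefschetz' fixed
  point formula in cohomological form; `Δ^* u = u · Δ`).
* §4 `gradedTrace_corrAction_comp_cross` — THE TRACE FORMULA ON CROSS PRODUCTS `u = p₁^* x ∪ p₂^* y`,
  `w = p₁^* x' ∪ p₂^* y'`: `(Σ_{a ≤ 2n} (-1)ᵃ Tr([w]_* ∘ [u]_* |Hᵃ)) · 1_X = p₁₊ p₂^* p₁₊ (u ∪ σ^* w)`, `σ` the swap of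
  `X ⊗ X` (`σ^* w = ᵗw`); the bilinear extension to all `u, w`, the injectivity of `t ↦ p₁₊ p₂^* p₁₊ t` on
  `H⁴ⁿ((X ⊗ X)(ℂ))` and the faithfulness of the total action are in the sequel `…TraceFormulaPairing`.

Both sides of §3–§4 are (bi)linear, so Künneth spanning (`kunnethSpan_complexBetti`) reduces them to cross products,
where §1 and `LinearMap.trace_smulRight` evaluate the traces and the projection formula evaluates the right-hand sides;
the signs `(-1)^{i·i} = (-1)ⁱ = (-1)ʲ` (`i + j = 2n`) match. No definition, no named fact, no sorry.
References: Kleiman1968AlgebraicCycles (§1.3 Prop. 1.3.6, §1.4), Andre1996Motifs (Prop. 3.1 p. 20, Prop. 3.3 p. 21),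
FultonYoungTableaux1997 (App. B (5)–(6)), HatcherAT2002 (§3.2 Thm. 3.15–3.16, §3.3 Thm. 3.26, 3.30).
-/

noncomputable section

-- every declaration of this problem lives in `Summit.HodgeConjecture.HodgeConjecture.…` (summit = sub-problem)
set_option linter.dupNamespace false

open CategoryTheory AlgebraicGeometry MonoidalCategory CartesianMonoidalCategory
open Literature.AlgebraicTopology.SingularHomology Literature.Geometry.Kaehler
open Literature.AlgebraicGeometry Literature.AlgebraicGeometry.Motives
  Literature.AlgebraicGeometry.HodgeTheory

namespace Summit.HodgeConjecture.HodgeConjecture.Theorems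

variable (μ : OrientationFamily) {n : ℕ} {X : SchemeOver ℂ}

/-! ## §1 Cross products act as rank-one operators -/

/-- **The action of a cross product, all degrees.** For `x ∈ Hⁱ(X(ℂ))`, `y ∈ Hʲ(X(ℂ))` with `i + j = 2n` and
`c ∈ Hᵃ(X(ℂ))`: `[p₁^* x ∪ p₂^* y]_* c = (-1)^{a i} • p₁₊(p₁^* x ∪ p₂^*(c ∪ y))` (graded commutativity and
`p₂^* c ∪ p₂^* y = p₂^*(c ∪ y)`). [cite: Kleiman1968AlgebraicCycles, §1.3 Prop. 1.3.6] [cite: HatcherAT2002, §3.2 Prop. 3.10 and Thm. 3.11] -/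
theorem corrAction_cross_apply (hX : IsSmoothProjective n X) {i j a k : ℕ} (hij : i + j = 2 * n) (hk : a + j = k)
    (x : complexBetti X i) (y : complexBetti X j) (c : complexBetti X a) :
    corrAction μ hX hX (rfl : a + 2 * n = a + 2 * n)
        (cupProduct hij (complexBetti.map (fst X X) i x) (complexBetti.map (snd X X) j y)) c =
      ((-1 : ℂ) ^ (a * i)) • complexGysin μ (IsSmoothProjective.tensor_holds hX hX) hX (fst X X)
        (show a + 2 * n + 2 * n = a + 2 * (n + n) by omega)
        (cupProduct (show i + k = a + 2 * n by omega) (complexBetti.map (fst X X) i x)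
          (complexBetti.map (snd X X) k (cupProduct hk c y))) := by
  rw [corrAction_apply, ← cupProduct_assoc (rfl : a + i = a + i) hij (show a + i + j = a + 2 * n by omega) rfl,
    cupProduct_gradedComm_holds ℂ _ (rfl : a + i = a + i) (show i + a = a + i by omega)
      (complexBetti.map (snd X X) a c) (complexBetti.map (fst X X) i x),
    map_smul, LinearMap.smul_apply, map_smul,
    cupProduct_assoc (show i + a = a + i by omega) hk (show a + i + j = a + 2 * n by omega)
      (show i + k = a + 2 * n by omega),
    ← complexBetti.map_cupProduct]

/-- **A cross product `p₁^* x ∪ p₂^* y` (`x ∈ Hⁱ`) acts as `0` on `Hᵃ(X(ℂ))` for `a ≠ i`**: for `a < i` the class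
`p₂^*(c ∪ y)` has degree below the fibre dimension `2n` of `p₁` and `p₁₊(p₁^* x ∪ p₂^*(c ∪ y)) = 0`
(`complexGysin_cup_map_eq_zero_of_lt`); for `a > i`, `c ∪ y ∈ H^{>2n}(X(ℂ)) = 0`.
[cite: Kleiman1968AlgebraicCycles, §1.3 Prop. 1.3.6] [cite: HatcherAT2002, §3.3 Thm. 3.26] -/
theorem corrAction_cross_eq_zero_of_ne (hX : IsSmoothProjective n X) {i j a : ℕ} (hij : i + j = 2 * n)
    (hai : a ≠ i) (x : complexBetti X i) (y : complexBetti X j) :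
    corrAction μ hX hX (rfl : a + 2 * n = a + 2 * n)
        (cupProduct hij (complexBetti.map (fst X X) i x) (complexBetti.map (snd X X) j y)) = 0 := by
  refine LinearMap.ext fun c ↦ ?_
  rw [LinearMap.zero_apply, corrAction_cross_apply μ hX hij (rfl : a + j = a + j) x y c]
  rcases Nat.lt_or_gt_of_ne hai with h | h
  · rw [complexGysin_cup_map_eq_zero_of_lt (IsSmoothProjective.tensor_holds hX hX) hX (fst X X)
        (show i + (a + j) = a + 2 * n by omega) _ (by omega) x, smul_zero]
  · haveI := subsingleton_complexBetti hX (show 2 * n < a + j by omega)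
    rw [Subsingleton.elim (cupProduct (rfl : a + j = a + j) c y) 0, map_zero, map_zero, map_zero, smul_zero]

/-- **A cross product `p₁^* x ∪ p₂^* y` (`x ∈ Hⁱ`, `y ∈ Hʲ`, `i + j = 2n`) acts on `Hⁱ(X(ℂ))` as the rank-one operator
`c ↦ (-1)ⁱ x ∪ p₁₊ p₂^*(c ∪ y)`** (projection formula `p₁₊(p₁^* x ∪ z) = x ∪ p₁₊ z`; `(-1)^{i i} = (-1)ⁱ`).
[cite: Kleiman1968AlgebraicCycles, §1.3 Prop. 1.3.6] [cite: FultonYoungTableaux1997, Appendix B §B.1 (6)] -/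
theorem corrAction_cross_apply_self (hX : IsSmoothProjective n X) {i j : ℕ} (hij : i + j = 2 * n)
    (x : complexBetti X i) (y : complexBetti X j) (c : complexBetti X i) :
    corrAction μ hX hX (rfl : i + 2 * n = i + 2 * n)
        (cupProduct hij (complexBetti.map (fst X X) i x) (complexBetti.map (snd X X) j y)) c =
      ((-1 : ℂ) ^ i) • cupProduct (Nat.add_zero i) x
        (complexGysin μ (IsSmoothProjective.tensor_holds hX hX) hX (fst X X)
          (show 2 * n + 2 * n = 0 + 2 * (n + n) by omega) (complexBetti.map (snd X X) (2 * n) (cupProduct hij c y))) := by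
  have hμ : μ.HasPoincareDuality := OrientationFamily.hasPoincareDuality μ
  rw [corrAction_cross_apply μ hX hij hij x y c,
    complexGysin_cup hμ (IsSmoothProjective.tensor_holds hX hX) hX (fst X X) (show i + 2 * n = i + 2 * n by omega) _
      (show 2 * n + 2 * n = 0 + 2 * (n + n) by omega) (Nat.add_zero i) x]
  congr 1
  rcases Nat.even_or_odd i with hi | hi
  · rw [hi.neg_one_pow, (Nat.even_mul.mpr (Or.inl hi)).neg_one_pow]
  · rw [hi.neg_one_pow, (Nat.odd_mul.mpr ⟨hi, hi⟩).neg_one_pow]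

/-! ## §2 The degree-zero fibre integral `p₁₊ p₂^* : H²ⁿ(X(ℂ)) → H⁰(X(ℂ)) = ℂ · 1_X` -/

/-- **`p₁₊ p₂^* w = φ(w) · 1_X`** for a linear functional `φ` on `H²ⁿ(X(ℂ); ℂ)`: the degree-`0` class `p₁₊ p₂^* w`
lies on the line `H⁰(X(ℂ); ℂ) = ℂ · 1` (`exists_eq_smul_one`), and the coordinate is read off by a linear functional
`ℓ` with `ℓ(1) = 1` (or `φ = 0` if `1 = 0`). [cite: HatcherAT2002, §3.3 Thm. 3.26 and Thm. 3.30] -/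
theorem exists_fibreIntegral (hX : IsSmoothProjective n X) :
    ∃ φ : complexBetti X (2 * n) →ₗ[ℂ] ℂ, ∀ w : complexBetti X (2 * n),
      complexGysin μ (IsSmoothProjective.tensor_holds hX hX) hX (fst X X)
          (show 2 * n + 2 * n = 0 + 2 * (n + n) by omega) (complexBetti.map (snd X X) (2 * n) w) =
        φ w • singularCohomology.one ℂ (ComplexPoints X) := by
  set I : complexBetti X (2 * n) →ₗ[ℂ] complexBetti X 0 :=
    complexGysin μ (IsSmoothProjective.tensor_holds hX hX) hX (fst X X)
        (show 2 * n + 2 * n = 0 + 2 * (n + n) by omega) ∘ₗ (complexBetti.map (snd X X) (2 * n)).hom with hI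
  by_cases h1 : singularCohomology.one ℂ (ComplexPoints X) = 0
  · refine ⟨0, fun w ↦ ?_⟩
    obtain ⟨t, ht⟩ := exists_eq_smul_one μ hX (I w)
    change I w = _
    rw [ht, h1, smul_zero, smul_zero]
  · obtain ⟨ℓ, -, hℓ⟩ := LinearMap.exists_extend_of_notMem (p := (⊥ : Submodule ℂ (complexBetti X 0)))
      (0 : (⊥ : Submodule ℂ (complexBetti X 0)) →ₗ[ℂ] ℂ) (by rwa [Submodule.mem_bot]) (1 : ℂ)
    refine ⟨ℓ ∘ₗ I, fun w ↦ ?_⟩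
    obtain ⟨t, ht⟩ := exists_eq_smul_one μ hX (I w)
    change I w = ℓ (I w) • _
    rw [ht, map_smul, hℓ, smul_eq_mul, mul_one]

/-- **`1_X ≠ 0` in `H⁰(X(ℂ); ℂ)`** for `X` smooth projective (`X(ℂ)` is a non-empty closed manifold:
`1 ⌢ [X(ℂ)] = [X(ℂ)] ≠ 0` for the complex orientation). [cite: HatcherAT2002, §3.2 p. 211 and §3.3 Thm. 3.26] -/
theorem complexBetti_one_ne_zero (hX : IsSmoothProjective n X) : singularCohomology.one ℂ (ComplexPoints X) ≠ 0 := by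
  letI := hX.chartedSpace
  haveI := ComplexPoints.compactSpace_of_isSmoothProjective hX
  haveI := ComplexPoints.t2Space_of_isSmoothProjective hX
  haveI := connectedSpace_complexPoints hX
  intro h
  apply fundamentalClass_ne_zero (complexOrientationFamily hX)
  rw [← one_capProduct (complexOrientationFamily hX).fundamentalClass, h, map_zero, LinearMap.zero_apply]

/-! ## §3 The graded trace of `[u]_*` (Lefschetz' fixed point formula, cohomological form) -/

/-- **`(Σ_{a ≤ 2n} (-1)ᵃ Tr([u]_* | Hᵃ(X(ℂ)))) · 1_X = p₁₊ p₂^* Δ^* u`** for every `u ∈ H²ⁿ((X ⊗ X)(ℂ); ℂ)` (`X` smooth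
projective of dimension `n`, any orientation family). Both sides are linear in `u`; on a cross product
`u = p₁^* x ∪ p₂^* y` (`x ∈ Hⁱ`, `y ∈ Hʲ`), only `a = i` contributes (§1), with `Tr = (-1)ⁱ φ(x ∪ y)`
(`LinearMap.trace_smulRight`), while `Δ^* u = x ∪ y` and `p₁₊ p₂^*(x ∪ y) = φ(x ∪ y) · 1`.
[cite: Kleiman1968AlgebraicCycles, §1.3 Prop. 1.3.6] [cite: HatcherAT2002, §3.2 Thm. 3.16] -/
theorem gradedTrace_corrAction_smul_one (hX : IsSmoothProjective n X) (u : complexBetti (X ⊗ X) (2 * n)) :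
    (∑ a ∈ Finset.range (2 * n + 1),
        (-1 : ℂ) ^ a * LinearMap.trace ℂ _ (corrAction μ hX hX (rfl : a + 2 * n = a + 2 * n) u)) •
        singularCohomology.one ℂ (ComplexPoints X) =
      complexGysin μ (IsSmoothProjective.tensor_holds hX hX) hX (fst X X)
        (show 2 * n + 2 * n = 0 + 2 * (n + n) by omega)
        (complexBetti.map (snd X X) (2 * n) (complexBetti.map (lift (𝟙 X) (𝟙 X)) (2 * n) u)) := by
  have hXX := IsSmoothProjective.tensor_holds hX hX
  obtain ⟨φ, hφ⟩ := exists_fibreIntegral μ hX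
  -- both sides are linear in `u`
  let G : complexBetti (X ⊗ X) (2 * n) →ₗ[ℂ] complexBetti X 0 :=
    (∑ a ∈ Finset.range (2 * n + 1), ((-1 : ℂ) ^ a) •
      ((LinearMap.trace ℂ (complexBetti X a)) ∘ₗ corrAction μ hX hX (rfl : a + 2 * n = a + 2 * n))).smulRight
      (singularCohomology.one ℂ (ComplexPoints X))
  let F : complexBetti (X ⊗ X) (2 * n) →ₗ[ℂ] complexBetti X 0 :=
    complexGysin μ hXX hX (fst X X) (show 2 * n + 2 * n = 0 + 2 * (n + n) by omega) ∘ₗ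
      (complexBetti.map (snd X X) (2 * n)).hom ∘ₗ (complexBetti.map (lift (𝟙 X) (𝟙 X)) (2 * n)).hom
  have hG : ∀ v, G v = (∑ a ∈ Finset.range (2 * n + 1),
      (-1 : ℂ) ^ a * LinearMap.trace ℂ _ (corrAction μ hX hX (rfl : a + 2 * n = a + 2 * n) v)) •
        singularCohomology.one ℂ (ComplexPoints X) := fun v ↦ by
    simp only [G, LinearMap.smulRight_apply, LinearMap.coe_sum, Finset.sum_apply, LinearMap.smul_apply,
      LinearMap.comp_apply, smul_eq_mul]
  rw [← hG]
  change G u = F u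
  refine LinearMap.eqOn_span (f := G) (g := F) ?_ (kunnethSpan_complexBetti hX hX (2 * n) u)
  rintro _ ⟨i, j, hij, x, y, rfl⟩
  rw [hG]
  change _ = complexGysin μ hXX hX (fst X X) _ (complexBetti.map (snd X X) (2 * n)
    (complexBetti.map (lift (𝟙 X) (𝟙 X)) (2 * n)
      (cupProduct hij (complexBetti.map (fst X X) i x) (complexBetti.map (snd X X) j y))))
  rw [map_lift_cross hij x y, hφ]
  -- only `a = i` contributes
  rw [Finset.sum_eq_single i]
  rotate_left
  · intro a _ hai
    rw [corrAction_cross_eq_zero_of_ne μ hX hij hai x y, map_zero, mul_zero]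
  · intro hi
    exact absurd (Finset.mem_range.mpr (by omega)) hi
  -- `[x ⊠ y]_* = (-1)ⁱ • (φ(· ∪ y)) ⊗ x` on `Hⁱ`
  have hT : corrAction μ hX hX (rfl : i + 2 * n = i + 2 * n)
      (cupProduct hij (complexBetti.map (fst X X) i x) (complexBetti.map (snd X X) j y)) =
      ((-1 : ℂ) ^ i) • ((φ ∘ₗ (cupProduct hij).flip y).smulRight x) := by
    refine LinearMap.ext fun c ↦ ?_
    rw [corrAction_cross_apply_self μ hX hij x y c, hφ, LinearMap.smul_apply, LinearMap.smulRight_apply,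
      LinearMap.comp_apply, LinearMap.flip_apply, map_smul, cupProduct_one]
  haveI : Module.Finite ℂ (complexBetti X i) := finite_complexBetti hX i
  rw [hT, map_smul, LinearMap.trace_smulRight, LinearMap.comp_apply, LinearMap.flip_apply, smul_eq_mul,
    ← mul_assoc, ← pow_add, ← two_mul, pow_mul, neg_one_sq, one_pow, one_mul]

/-! ## §4 The trace formula `Σₐ (-1)ᵃ Tr([w]_* ∘ [u]_* | Hᵃ) · 1 = p₁₊ p₂^* p₁₊ (u ∪ σ^* w)` on cross products -/

/-- The composite of two rank-one operators `(ψ' ⊗ x') ∘ (ψ ⊗ x) = ψ'(x) · (ψ ⊗ x')`. [folklore] -/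
theorem smulRight_comp_smulRight {V : Type*} [AddCommGroup V] [Module ℂ V] (ψ ψ' : V →ₗ[ℂ] ℂ) (x x' : V) :
    (ψ'.smulRight x') ∘ₗ (ψ.smulRight x) = (ψ' x) • ψ.smulRight x' := by
  refine LinearMap.ext fun c ↦ ?_
  simp only [LinearMap.comp_apply, LinearMap.smulRight_apply, map_smul, LinearMap.smul_apply,
    smul_smul, mul_comm]

/-- **The trace formula on a pair of cross products** (the generator case of `gradedTrace_corrAction_comp_smul_one`):
for `u = p₁^* x ∪ p₂^* y` (`x ∈ Hⁱ`, `y ∈ Hʲ`) and `w = p₁^* x' ∪ p₂^* y'` (`x' ∈ H^{i'}`, `y' ∈ H^{j'}`), both sides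
vanish unless `i = i'`, and for `i = i'` both equal `(-1)ⁱ φ(x ∪ y') φ(x' ∪ y) · 1_X` (`σ^* w = p₂^* x' ∪ p₁^* y'`,
`u ∪ σ^* w = ± p₁^*(x ∪ y') ∪ p₂^*(y ∪ x')`, rank-one traces by §1). [cite: Kleiman1968AlgebraicCycles, §1.3 Prop. 1.3.6]
[cite: HatcherAT2002, §3.2 Thm. 3.11 and Thm. 3.16] -/
theorem gradedTrace_corrAction_comp_cross (hX : IsSmoothProjective n X) {φ : complexBetti X (2 * n) →ₗ[ℂ] ℂ}
    (hφ : ∀ w : complexBetti X (2 * n),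
      complexGysin μ (IsSmoothProjective.tensor_holds hX hX) hX (fst X X)
          (show 2 * n + 2 * n = 0 + 2 * (n + n) by omega) (complexBetti.map (snd X X) (2 * n) w) =
        φ w • singularCohomology.one ℂ (ComplexPoints X))
    {i j i' j' : ℕ} (hij : i + j = 2 * n) (hij' : i' + j' = 2 * n) (x : complexBetti X i) (y : complexBetti X j)
    (x' : complexBetti X i') (y' : complexBetti X j') :
    (∑ a ∈ Finset.range (2 * n + 1), (-1 : ℂ) ^ a * LinearMap.trace ℂ _
        (corrAction μ hX hX (rfl : a + 2 * n = a + 2 * n)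
            (cupProduct hij' (complexBetti.map (fst X X) i' x') (complexBetti.map (snd X X) j' y')) ∘ₗ
          corrAction μ hX hX (rfl : a + 2 * n = a + 2 * n)
            (cupProduct hij (complexBetti.map (fst X X) i x) (complexBetti.map (snd X X) j y)))) •
        singularCohomology.one ℂ (ComplexPoints X) =
      complexGysin μ (IsSmoothProjective.tensor_holds hX hX) hX (fst X X)
        (show 2 * n + 2 * n = 0 + 2 * (n + n) by omega)
        (complexBetti.map (snd X X) (2 * n)
          (complexGysin μ (IsSmoothProjective.tensor_holds hX hX) hX (fst X X)
            (show 2 * (n + n) + 2 * n = 2 * n + 2 * (n + n) by omega)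
            (cupProduct (show 2 * n + 2 * n = 2 * (n + n) by omega)
              (cupProduct hij (complexBetti.map (fst X X) i x) (complexBetti.map (snd X X) j y))
              (complexBetti.map (β_ X X).hom (2 * n)
                (cupProduct hij' (complexBetti.map (fst X X) i' x') (complexBetti.map (snd X X) j' y')))))) := by
  have hμ : μ.HasPoincareDuality := OrientationFamily.hasPoincareDuality μ
  have hXX := IsSmoothProjective.tensor_holds hX hX
  -- `σ^* w = p₂^* x' ∪ p₁^* y'`
  have hσ : complexBetti.map (β_ X X).hom (2 * n)
      (cupProduct hij' (complexBetti.map (fst X X) i' x') (complexBetti.map (snd X X) j' y')) =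
      cupProduct hij' (complexBetti.map (snd X X) i' x') (complexBetti.map (fst X X) j' y') := by
    rw [complexBetti.map_cupProduct, ← complexBetti.map_comp_apply', ← complexBetti.map_comp_apply',
      braiding_hom_fst, braiding_hom_snd]
  rw [hσ]
  by_cases hii : i = i'
  · -- the diagonal case `i = i'`, `j = j'`
    subst hii
    have hjj : j = j' := by omega
    subst hjj
    have hji : j + i = 2 * n := by omega
    -- `u ∪ σ^* w = (-1)^{2n·j} • p₁^*(x ∪ y') ∪ p₂^*(y ∪ x')`
    have hcup : cupProduct (show 2 * n + 2 * n = 2 * (n + n) by omega)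
        (cupProduct hij (complexBetti.map (fst X X) i x) (complexBetti.map (snd X X) j y))
        (cupProduct hij' (complexBetti.map (snd X X) i x') (complexBetti.map (fst X X) j y')) =
        ((-1 : ℂ) ^ (2 * n * j)) • cupProduct (show 2 * n + 2 * n = 2 * (n + n) by omega)
          (complexBetti.map (fst X X) (2 * n) (cupProduct hij x y'))
          (complexBetti.map (snd X X) (2 * n) (cupProduct hji y x')) := by
      rw [cupProduct_assoc hij (rfl : j + 2 * n = j + 2 * n) (show 2 * n + 2 * n = 2 * (n + n) by omega)
          (show i + (j + 2 * n) = 2 * (n + n) by omega),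
        ← cupProduct_assoc hji hij' (show 2 * n + j = j + 2 * n by omega) (rfl : j + 2 * n = j + 2 * n),
        ← complexBetti.map_cupProduct,
        cupProduct_gradedComm_holds ℂ _ (show 2 * n + j = j + 2 * n by omega) (rfl : j + 2 * n = j + 2 * n)
          (complexBetti.map (snd X X) (2 * n) (cupProduct hji y x')) (complexBetti.map (fst X X) j y'),
        map_smul,
        ← cupProduct_assoc hij (rfl : j + 2 * n = j + 2 * n) (show 2 * n + 2 * n = 2 * (n + n) by omega)
          (show i + (j + 2 * n) = 2 * (n + n) by omega),
        ← complexBetti.map_cupProduct]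
    have heven : ((-1 : ℂ) ^ (2 * n * j)) = 1 := by rw [mul_assoc, pow_mul, neg_one_sq, one_pow]
    rw [hcup, heven, one_smul,
      complexGysin_cup hμ hXX hX (fst X X) (show 2 * n + 2 * n = 2 * (n + n) by omega) _
        (show 2 * n + 2 * n = 0 + 2 * (n + n) by omega) (Nat.add_zero (2 * n)) (cupProduct hij x y'),
      hφ, hφ, map_smul, cupProduct_one, map_smul, smul_eq_mul,
      cupProduct_gradedComm_holds ℂ _ hji hij y x', map_smul, smul_eq_mul]
    have h3 : ((-1 : ℂ) ^ i) * (-1) ^ i = 1 := by rw [← pow_add, ← two_mul, pow_mul, neg_one_sq, one_pow]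
    -- the left-hand side: only `a = i`
    rw [Finset.sum_eq_single i]
    rotate_left
    · intro a _ hai
      rw [corrAction_cross_eq_zero_of_ne μ hX hij hai x y, LinearMap.comp_zero, map_zero, mul_zero]
    · intro hi
      exact absurd (Finset.mem_range.mpr (by omega)) hi
    have hT : ∀ (h : i + j = 2 * n) (x₀ : complexBetti X i) (y₀ : complexBetti X j),
        corrAction μ hX hX (rfl : i + 2 * n = i + 2 * n)
          (cupProduct h (complexBetti.map (fst X X) i x₀) (complexBetti.map (snd X X) j y₀)) =
        ((-1 : ℂ) ^ i) • ((φ ∘ₗ (cupProduct hij).flip y₀).smulRight x₀) := by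
      intro h x₀ y₀
      refine LinearMap.ext fun c ↦ ?_
      rw [corrAction_cross_apply_self μ hX h x₀ y₀ c, hφ, LinearMap.smul_apply, LinearMap.smulRight_apply,
        LinearMap.comp_apply, LinearMap.flip_apply, map_smul, cupProduct_one]
    haveI : Module.Finite ℂ (complexBetti X i) := finite_complexBetti hX i
    rw [hT hij x y, hT hij' x' y', LinearMap.smul_comp, LinearMap.comp_smul, smul_smul, h3, one_smul,
      smulRight_comp_smulRight, map_smul, LinearMap.trace_smulRight, LinearMap.comp_apply, LinearMap.flip_apply,
      LinearMap.comp_apply, LinearMap.flip_apply, smul_eq_mul]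
    -- signs: `(-1)^i = (-1)^{j i}` (`i ≡ j (mod 2)`)
    have hsign : ((-1 : ℂ) ^ (j * i)) = (-1) ^ i := by
      rcases Nat.even_or_odd i with hi | hi
      · rw [hi.neg_one_pow, (Nat.even_mul.mpr (Or.inr hi)).neg_one_pow]
      · have hj : Odd j := by
          rcases Nat.even_or_odd j with hj | hj
          · exfalso
            obtain ⟨r, hr⟩ := hi
            obtain ⟨s, hs⟩ := hj
            omega
          · exact hj
        rw [hi.neg_one_pow, (Nat.odd_mul.mpr ⟨hj, hi⟩).neg_one_pow]
    rw [hsign]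
    congr 1
    ring
  · -- the off-diagonal case: both sides vanish
    rw [Finset.sum_eq_zero, zero_smul]
    swap
    · intro a _
      by_cases hai : a = i
      · subst hai
        rw [corrAction_cross_eq_zero_of_ne μ hX hij' hii x' y', LinearMap.zero_comp, map_zero, mul_zero]
      · rw [corrAction_cross_eq_zero_of_ne μ hX hij hai x y, LinearMap.comp_zero, map_zero, mul_zero]
    -- `u ∪ σ^* w = ± p₁^*(x ∪ y') ∪ p₂^*(y ∪ x')` with `deg (y ∪ x') = j + i' ≠ 2n`
    have hcup : cupProduct (show 2 * n + 2 * n = 2 * (n + n) by omega)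
        (cupProduct hij (complexBetti.map (fst X X) i x) (complexBetti.map (snd X X) j y))
        (cupProduct hij' (complexBetti.map (snd X X) i' x') (complexBetti.map (fst X X) j' y')) =
        ((-1 : ℂ) ^ ((j + i') * j')) • cupProduct (show (i + j') + (j + i') = 2 * (n + n) by omega)
          (complexBetti.map (fst X X) (i + j') (cupProduct rfl x y'))
          (complexBetti.map (snd X X) (j + i') (cupProduct rfl y x')) := by
      rw [cupProduct_assoc hij (rfl : j + 2 * n = j + 2 * n) (show 2 * n + 2 * n = 2 * (n + n) by omega)
          (show i + (j + 2 * n) = 2 * (n + n) by omega),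
        ← cupProduct_assoc (rfl : j + i' = j + i') hij' (show j + i' + j' = j + 2 * n by omega)
          (rfl : j + 2 * n = j + 2 * n),
        ← complexBetti.map_cupProduct,
        cupProduct_gradedComm_holds ℂ _ (show j + i' + j' = j + 2 * n by omega) (show j' + (j + i') = j + 2 * n by omega)
          (complexBetti.map (snd X X) (j + i') (cupProduct rfl y x')) (complexBetti.map (fst X X) j' y'),
        map_smul,
        ← cupProduct_assoc (rfl : i + j' = i + j') (show j' + (j + i') = j + 2 * n by omega)
          (show (i + j') + (j + i') = 2 * (n + n) by omega) (show i + (j + 2 * n) = 2 * (n + n) by omega),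
        ← complexBetti.map_cupProduct]
    rw [hcup, map_smul, map_smul, map_smul]
    rcases Nat.lt_or_gt_of_ne (show j + i' ≠ 2 * n by omega) with hlt | hgt
    · rw [complexGysin_cup_map_eq_zero_of_lt hXX hX (fst X X) (show (i + j') + (j + i') = 2 * (n + n) by omega) _
        (by omega), map_zero, map_zero, smul_zero]
    · haveI := subsingleton_complexBetti hX hgt
      rw [Subsingleton.elim (cupProduct (rfl : j + i' = j + i') y x') 0, map_zero, map_zero, map_zero, map_zero,
        map_zero, smul_zero]

end Summit.HodgeConjecture.HodgeConjecture.Theorems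

end
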